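import Summits.QuantumFields.YangMills.Theorems.UnitScaleTiltProp7PinnedPeelingEL
import Summits.QuantumFields.YangMills.Theorems.UnitScaleTiltProp7PinnedBiharmonicAgmonWindow
import Summits.QuantumFields.YangMills.Theorems.UnitScaleTiltProp7TorusExpWeightSum
import HarnessLib

/-!
# Route `UnitScaleTilt`, crux K1 «MinimiserStabilityRegPr» (stmt-QuantumFields-19200), route-R E′ path (α′), residue (hK), assembly (A), row (A-door):
# THE ABSTRACT ASSEMBLY OF THE KERNEL BOUND — the ℓ¹ mass of `Δ(V − U)` (`U` a pinned-biharmonic interpolant of `V`, `Δ²V = f`) from SEVEN displayed numbers: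
# the weighted ℓ² sizes of the three localised Euler–Lagrange sources of the peeled remainder (✓ `Prop7PinnedPeelingEL.el_of_peeled`), the torus sum
# `√Σω⁻²`, the ℓ¹ masses of `Δ(χV)` and of `Δu` (u an extension of the near datum `(χV)|_C`), and the weighted ℓ² size of `Δu`

Cell `ym3-torus`, width seat `ym3-torus-px22` (gen 2), on ★routeR-w3 g5's rows «(A3) LOCATE», «(EL-loc)», «(Lλ)» (19:28–19:47Z); LOCATE 19200 evidence
`LOCATE-A3-FARFIELD-px22g2.md` v1.2 §2–§5.  `--supports stmt-QuantumFields-19200`, count-neutral.  THEOREMS ONLY (0 `def`, 0 `sorry`).  YM₃ on T³ is a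
ladder rung (R3), not the Clay problem; nothing here claims the stub, the crux, d = 4 or the gap.

THE DECOMPOSITION (LOCATE §2, in ✓p662031's letters).  `w := V − U` with `U|_C = V|_C`, `Δ²U = 0` off `C`; `χ` a cutoff with `(1−χ)f = 0`; `u` any extension of
`(χV)|_C` with a pinned-biharmonic interpolant `U₂`; `U₁ := U − U₂` then interpolates `((1−χ)V)|_C`.  So
    `V − U = [(1−χ)V − U₁] + [χV − u] + [u − U₂]`,
the first bracket is pinned and satisfies the three-source EL identity of ✓ `el_of_peeled` (`h = χg − Δ(χV)`, `ht = −g(b₋)∂χ`, `s = Σ_μ∂χ∂g`), the third is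
the interpolation error of `u` (type-1 source `Δu`, ✓ `el_of_biharmonic_off`); both go through ✓ `weighted_laplace_le_window` and the `ℓ² → ℓ¹` converter
✓ `sum_abs_le_sqrt_mul_sqrt`; the middle bracket is explicit.

WHAT IS PROVED (ns `…Theorems.Prop7PinnedKernelL1OfRows`; torus `T^{(j)}`, any `d`, lattice factor `c`, centre set `C`, real site fields).
* §1 `sum_abs_laplace_sub_le` (triangle inequality for `Σ|Δ(F₁ − F₂)|`), `sum_abs_laplace_le_of_weighted` (`Σ|ΔF| ≤ √Σω⁻²·√Σ(ωΔF)²`),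
  `sum_abs_laplace_interp_error_le` (`Σ|Δ(u − U₂)| ≤ W·3·N₄` — the interpolation-error instance).
* §2 ★★★ `sum_abs_laplace_sub_interp_le_of_rows` —
  `Σ_z|Δ(V − U)(z)| ≤ W·(3·Nh + 5√A·Nht + 5A·Ns) + N₂ + N₃ + W·(3·N₄)`.
HONEST SCOPE.  Pure assembly: every analytic input is a displayed NUMBER (`Nh Nht Ns W N₂ N₃ N₄ A`) or row (weight rows, window rows, root-form Poincaré);
the instantiation on `Site P 0` (`C = range (embIter k)`, ✓p662031 `exists_green_site_split`, (R4)(R5)(R5c)(Hess3)(W1)(W2)(W3-lite)(D1-glob)(cnt)) that turns this into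
`Σ_z|K(b,z)| ≤ c_I·L^k` and `exact`s ✓p654411 is the next file.  Flat letters only.

References: T. Bałaban, CMP 96 (1984) 223–250 [Balaban1984PropagatorsII] ((1.9) p.226, (2.61) p.234); CMP 99 (1985) 75–102 [Balaban1985RegularSpaces] ((1.14) p.78,
(1.36) p.82); CMP 102 (1985) 277–309 [Balaban1985Variational] (Prop. 7 p.299).
-/

set_option autoImplicit false

noncomputable section

open scoped BigOperators

namespace Summit.QuantumFields.YangMills.Theorems.Prop7PinnedKernelL1OfRows

open Literature.MathematicalPhysics.QuantumFieldTheory.Balaban1983to89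
open Finset LatticeFieldCalculus
open Summit.QuantumFields.YangMills.Theorems.Prop7CentreHarmonicInterpKernel (laplace_sub')
open Summit.QuantumFields.YangMills.Theorems.Prop7PinnedBiharmonicAgmonDecay (el_of_biharmonic_off)
open Summit.QuantumFields.YangMills.Theorems.Prop7PinnedBiharmonicAgmonWindow (weighted_laplace_le_window)
open Summit.QuantumFields.YangMills.Theorems.Prop7TorusExpWeightSum (sum_abs_le_sqrt_mul_sqrt)
open Summit.QuantumFields.YangMills.Theorems.Prop7PinnedPeelingEL (el_of_peeled)

variable {P : Params} {j : ℕ}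

/-! ## §1 Bookkeeping -/

/-- `Σ|Δ(F₁ − F₂)| ≤ Σ|ΔF₁| + Σ|ΔF₂|`. [folklore] -/
theorem sum_abs_laplace_sub_le (c : ℝ) (F₁ F₂ : SiteField P j ℝ) :
    ∑ z, |laplace c (fun x => F₁ x - F₂ x) z| ≤ ∑ z, |laplace c F₁ z| + ∑ z, |laplace c F₂ z| := by
  rw [laplace_sub', ← Finset.sum_add_distrib]
  exact Finset.sum_le_sum fun z _ => abs_sub _ _

/-- `Σ|Δ(F₁ + F₂)| ≤ Σ|ΔF₁| + Σ|ΔF₂|`. [folklore] -/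
theorem sum_abs_laplace_add_le (c : ℝ) (F₁ F₂ : SiteField P j ℝ) :
    ∑ z, |laplace c (fun x => F₁ x + F₂ x) z| ≤ ∑ z, |laplace c F₁ z| + ∑ z, |laplace c F₂ z| := by
  have e : (fun x => F₁ x + F₂ x) = fun x => F₁ x - (-F₂ x) := funext fun x => by ring
  have e2 : (fun x => -F₂ x) = fun x => (0 : ℝ) - F₂ x := funext fun x => by ring
  rw [e]
  refine (sum_abs_laplace_sub_le c F₁ (fun x => -F₂ x)).trans ?_
  rw [e2, laplace_sub']
  simp [laplace]

/-- the `ℓ² → ℓ¹` converter in `laplace` letters: `Σ|ΔF| ≤ √Σω⁻²·√Σ(ωΔF)²`. [folklore] -/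
theorem sum_abs_laplace_le_of_weighted (c : ℝ) (ω F : SiteField P j ℝ) (hω₀ : ∀ x, 0 < ω x) {W : ℝ}
    (hW : Real.sqrt (∑ z, (ω z)⁻¹ ^ 2) ≤ W) :
    ∑ z, |laplace c F z| ≤ W * Real.sqrt (∑ z, (ω z * laplace c F z) ^ 2) :=
  (sum_abs_le_sqrt_mul_sqrt Finset.univ ω (laplace c F) fun x _ => hω₀ x).trans
    (mul_le_mul_of_nonneg_right hW (Real.sqrt_nonneg _))

/-- **THE INTERPOLATION-ERROR INSTANCE**: for `U₂` a pinned-biharmonic interpolant of `u|_C`, under the weight∕window∕Poincaré rows,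
`Σ|Δ(u − U₂)| ≤ W·(3·N₄)` with `N₄ ≥ √Σ(ωΔu)²`, `W ≥ √Σω⁻²`. [cite: Balaban1984PropagatorsII, (1.9) p.226] -/
theorem sum_abs_laplace_interp_error_le (c : ℝ) (C : Set (Site P j)) (ω u U₂ : SiteField P j ℝ)
    {a b A W N₄ : ℝ} (ha0 : 0 ≤ a) (hb0 : 0 ≤ b) (hA : 0 ≤ A)
    (hω₀ : ∀ x, 0 < ω x)
    (hω₁ : ∀ x μ, |ω (x.shift μ) - ω x| ≤ a * ω x ∧ |ω (x.unshift μ) - ω x| ≤ a * ω x)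
    (hω₂ : ∀ x μ, |ω (x.shift μ) + ω (x.unshift μ) - 2 * ω x| ≤ b * ω x)
    (hP : ∀ v : SiteField P j ℝ, (∀ y ∈ C, v y = 0) →
      Real.sqrt (∑ x, v x ^ 2) ≤ A * Real.sqrt (∑ x, laplace c v x ^ 2))
    (ha : a ≤ 1 / 2) (hwin₁ : a * |c| * Real.sqrt P.d * Real.sqrt A ≤ 1 / 100) (hwin₂ : b * c ^ 2 * P.d * A ≤ 1 / 50)
    (hU₂C : ∀ x ∈ C, U₂ x = u x) (hU₂el : ∀ x ∉ C, laplace c (laplace c U₂) x = 0)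
    (hW : Real.sqrt (∑ z, (ω z)⁻¹ ^ 2) ≤ W) (hN₄ : Real.sqrt (∑ z, (ω z * laplace c u z) ^ 2) ≤ N₄) :
    ∑ z, |laplace c (fun x => u x - U₂ x) z| ≤ W * (3 * N₄) := by
  have he : ∀ y ∈ C, (fun x => u x - U₂ x) y = 0 := fun y hy => by simp [hU₂C y hy]
  have hEL' := el_of_biharmonic_off c C u U₂ hU₂el
  have hwl := (weighted_laplace_le_window c C ω (fun x => u x - U₂ x) (laplace c u) (fun _ => (0 : ℝ)) (fun _ => (0 : ℝ))
    ha0 hb0 hA hω₀ hω₁ hω₂ hP he hEL' ha hwin₁ hwin₂).1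
  simp only [mul_zero, ne_eq, OfNat.ofNat_ne_zero, not_false_eq_true, zero_pow, Finset.sum_const_zero,
    Real.sqrt_zero, add_zero] at hwl
  have hW0 : 0 ≤ W := (Real.sqrt_nonneg _).trans hW
  calc ∑ z, |laplace c (fun x => u x - U₂ x) z|
      ≤ W * Real.sqrt (∑ z, (ω z * laplace c (fun x => u x - U₂ x) z) ^ 2) := sum_abs_laplace_le_of_weighted c ω _ hω₀ hW
    _ ≤ W * (3 * N₄) := mul_le_mul_of_nonneg_left (hwl.trans (by linarith)) hW0

/-! ## §2 ★★★ The abstract assembly -/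

/-- ★★★ **THE KERNEL'S ℓ¹ MASS FROM SEVEN NUMBERS.**  Torus `T^{(j)}`, lattice factor `c`, centres `C`.  DATA: `ΔV = g`, `Δg = f`; `U` a pinned-biharmonic
interpolant of `V` (`U|_C = V|_C`, `Δ²U = 0` off `C`); a cutoff `χ` with `(1 − χ)·f = 0`; an extension `u` of the near datum (`u|_C = (χV)|_C`) with a
pinned-biharmonic interpolant `U₂`; a weight `ω` with (D2′)'s two rows, the root-form pinned Poincaré constant `A`, the numeric window; and bounds
`√Σ(ω·(χg − Δ(χV)))² ≤ Nh`, `√Σ_b(ω(b₋)·g(b₋)∂χ(b))² ≤ Nht`, `√Σ(ω·Σ_μ∂χ∂g)² ≤ Ns`, `√Σω⁻² ≤ W`, `Σ|Δ(χV)| ≤ N₂`, `Σ|Δu| ≤ N₃`, `√Σ(ωΔu)² ≤ N₄`.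
THEN `Σ_z|Δ(V − U)(z)| ≤ W·(3Nh + 5√A·Nht + 5A·Ns) + N₂ + N₃ + W·(3N₄)`.
With `V = Gf b₊ − Gf b₋`, `U = Uf b₊ − Uf b₋` of ✓ `Prop7GreenKernelSiteTransport.exists_green_site_split` this is (hK) `Σ_z|K(b,z)| ≤ c_I·ℓ` of
✓ `Prop7CentreHarmonicInterpKernel.norm_grad_interp_error_le` up to the factor `|c|`, once the seven numbers are read at scale `ℓ = L^k`
(`Nh, N₄ ≍ ℓ^{−1∕2}`, `Nht ≍ ℓ^{−3∕2}`, `Ns ≍ ℓ^{−5∕2}`, `W ≍ ℓ^{3∕2}`, `√A ≍ ℓ`, `N₂, N₃ ≍ ℓ`).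
[cite: Balaban1984PropagatorsII, (1.9) p.226; Balaban1985RegularSpaces, (1.36) p.82; Balaban1985Variational, Prop. 7 p.299] -/
theorem sum_abs_laplace_sub_interp_le_of_rows (c : ℝ) (C : Set (Site P j))
    (χ V g f U u U₂ ω : SiteField P j ℝ)
    {a b A W Nh Nht Ns N₂ N₃ N₄ : ℝ} (ha0 : 0 ≤ a) (hb0 : 0 ≤ b) (hA : 0 ≤ A)
    -- the objects
    (hg : laplace c V = g) (hf : laplace c g = f) (hχf : ∀ x, (1 - χ x) * f x = 0)
    (hUC : ∀ x ∈ C, U x = V x) (hUel : ∀ x ∉ C, laplace c (laplace c U) x = 0)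
    (hu : ∀ x ∈ C, u x = χ x * V x)
    (hU₂C : ∀ x ∈ C, U₂ x = u x) (hU₂el : ∀ x ∉ C, laplace c (laplace c U₂) x = 0)
    -- the weight, the Poincaré row, the window
    (hω₀ : ∀ x, 0 < ω x)
    (hω₁ : ∀ x μ, |ω (x.shift μ) - ω x| ≤ a * ω x ∧ |ω (x.unshift μ) - ω x| ≤ a * ω x)
    (hω₂ : ∀ x μ, |ω (x.shift μ) + ω (x.unshift μ) - 2 * ω x| ≤ b * ω x)
    (hP : ∀ v : SiteField P j ℝ, (∀ y ∈ C, v y = 0) →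
      Real.sqrt (∑ x, v x ^ 2) ≤ A * Real.sqrt (∑ x, laplace c v x ^ 2))
    (ha : a ≤ 1 / 2) (hwin₁ : a * |c| * Real.sqrt P.d * Real.sqrt A ≤ 1 / 100) (hwin₂ : b * c ^ 2 * P.d * A ≤ 1 / 50)
    -- the seven numbers
    (hNh : Real.sqrt (∑ z, (ω z * (χ z * g z - laplace c (fun y => χ y * V y) z)) ^ 2) ≤ Nh)
    (hNht : Real.sqrt (∑ b' : PBond P j, (ω b'.src * (-(g b'.src * grad c χ b'))) ^ 2) ≤ Nht)
    (hNs : Real.sqrt (∑ z, (ω z * (∑ μ : Fin P.d, grad c χ ⟨z, μ⟩ * grad c g ⟨z, μ⟩)) ^ 2) ≤ Ns)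
    (hW : Real.sqrt (∑ z, (ω z)⁻¹ ^ 2) ≤ W)
    (hN₂ : ∑ z, |laplace c (fun y => χ y * V y) z| ≤ N₂)
    (hN₃ : ∑ z, |laplace c u z| ≤ N₃)
    (hN₄ : Real.sqrt (∑ z, (ω z * laplace c u z) ^ 2) ≤ N₄) :
    ∑ z, |laplace c (fun x => V x - U x) z|
      ≤ W * (3 * Nh + 5 * Real.sqrt A * Nht + 5 * A * Ns) + N₂ + N₃ + W * (3 * N₄) := by
  have hW0 : 0 ≤ W := (Real.sqrt_nonneg _).trans hW
  -- the three brackets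
  set e : SiteField P j ℝ := fun x => (1 - χ x) * V x - (U x - U₂ x) with he_def
  set m : SiteField P j ℝ := fun x => χ x * V x - u x with hm_def
  set r : SiteField P j ℝ := fun x => u x - U₂ x with hr_def
  have hsplit : (fun x => V x - U x) = fun x => e x + (m x + r x) := by
    funext x; simp only [he_def, hm_def, hr_def]; ring
  -- (T1): the peeled remainder
  have he0 : ∀ y ∈ C, e y = 0 := by
    intro y hy
    simp only [he_def, hUC y hy, hU₂C y hy, hu y hy]
    ring
  have hU₁el : ∀ x ∉ C, laplace c (laplace c (fun y => U y - U₂ y)) x = 0 := by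
    intro x hx
    rw [laplace_sub', laplace_sub']
    dsimp only
    rw [hUel x hx, hU₂el x hx, sub_zero]
  have hELe := el_of_peeled c C χ V g f (fun y => U y - U₂ y) hg hf hχf hU₁el
  have hwl := (weighted_laplace_le_window c C ω e
    (fun z => χ z * g z - laplace c (fun y => χ y * V y) z)
    (fun z => ∑ μ : Fin P.d, grad c χ ⟨z, μ⟩ * grad c g ⟨z, μ⟩)
    (fun b' => -(g b'.src * grad c χ b'))
    ha0 hb0 hA hω₀ hω₁ hω₂ hP he0 (fun v hv => hELe v hv) ha hwin₁ hwin₂).1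
  have hT1 : ∑ z, |laplace c e z| ≤ W * (3 * Nh + 5 * Real.sqrt A * Nht + 5 * A * Ns) := by
    refine (sum_abs_laplace_le_of_weighted c ω e hω₀ hW).trans (mul_le_mul_of_nonneg_left (hwl.trans ?_) hW0)
    have h5A : 0 ≤ 5 * Real.sqrt A := by positivity
    have h5A' : 0 ≤ 5 * A := by positivity
    nlinarith [mul_le_mul_of_nonneg_left hNht h5A, mul_le_mul_of_nonneg_left hNs h5A', hNh]
  -- (T2)+(T3): the explicit middle bracket
  have hT23 : ∑ z, |laplace c m z| ≤ N₂ + N₃ :=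
    (sum_abs_laplace_sub_le c (fun y => χ y * V y) u).trans (add_le_add hN₂ hN₃)
  -- (T4): the interpolation error of `u`
  have hT4 : ∑ z, |laplace c r z| ≤ W * (3 * N₄) :=
    sum_abs_laplace_interp_error_le c C ω u U₂ ha0 hb0 hA hω₀ hω₁ hω₂ hP ha hwin₁ hwin₂ hU₂C hU₂el hW hN₄
  -- sum
  rw [hsplit]
  calc ∑ z, |laplace c (fun x => e x + (m x + r x)) z|
      ≤ ∑ z, |laplace c e z| + ∑ z, |laplace c (fun x => m x + r x) z| := sum_abs_laplace_add_le c e _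
    _ ≤ ∑ z, |laplace c e z| + (∑ z, |laplace c m z| + ∑ z, |laplace c r z|) :=
        add_le_add le_rfl (sum_abs_laplace_add_le c m r)
    _ ≤ W * (3 * Nh + 5 * Real.sqrt A * Nht + 5 * A * Ns) + ((N₂ + N₃) + W * (3 * N₄)) :=
        add_le_add hT1 (add_le_add hT23 hT4)
    _ = W * (3 * Nh + 5 * Real.sqrt A * Nht + 5 * A * Ns) + N₂ + N₃ + W * (3 * N₄) := by ring

end Summit.QuantumFields.YangMills.Theorems.Prop7PinnedKernelL1OfRows

end
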